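/-
Copyright: the b2b-balaban T⁴-continuum CRUX team, row NE7b owner lineage `t4-ne7b-p1` (gen 116). Project licence.
-/
import Summits.QuantumFields.BalabanUV.T4Continuum.Spine.NE7b.SupBackgroundRegionInstance
import Summits.QuantumFields.BalabanUV.T4Continuum.Spine.NE7b.SupPhiFourBackground

/-!
# THE SMALL-FIELD REGION LETTERS OF LATTICE `φ⁴`: for the background `σ` of the `φ⁴_d` skeleton (`u(t) = g·t³ + m·t`, field window
# `ρ`, `2(3|g|ρ² + |m|) ≤ c < N⁻¹`, every side, `d ≥ 3`) and any admissible rate `μ`, two coarse fields in the chart ball that agree to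
# within `ω` on the `D` blocks around `blk p` have backgrounds with `|(σw′ − σw)(p)| ≤ K₁(μ)(ω + ‖w′ − w‖e^{−μD})` and
# `|∇_ν(σw′ − σw)(p)| ≤ (n+1)⁻¹K₁′(μ)(ω + ‖w′ − w‖e^{−μD})` — the sup road's locality column ON THE MODEL IT IS FOR
# (row NE7b, node U5c; the owner's region instance + `φ⁴` background BY NAME; [folklore])

Cell `pub-balaban`, sub-cell `t4`, spine estimate NE7b (`T4WeightBudget.RelWeightBound`; the cell's OWN estimate — NOT PRINTED in
[Bałaban 1983–89], NOT PROVED).  Crux-route work under `Spine/NE7b/` by the row OWNER (`t4-ne7b-p1` gen 116) under FREEZE (0)'s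
crux-prover clause (FILING-CLAIM C-ne7bp1-g116-12); NOTHING of Bałaban's is named, valued or asserted; no `T4Continuum/Support` leaf
typed; no `def`, no notation; zero `sorry`.  Imports (BY NAME): the owner's `…SupBackgroundRegionInstance` (`region_pair_value`,
`region_pair_gradient` — window form; through it `…SupBackgroundGradientLocalised.exists_chart_gradient_weighted`) and
`…SupPhiFourBackground` (`exists_phiFour_background`; through it leaf-04's SISL §3).

WHY (located).  The region instance file assembled the locality column for (60)'s GLOBALLY Lipschitz terms and stated its readers for
terms Lipschitz on a WINDOW containing the fields' values; the `φ⁴` background file put the model's term `g·t³ + m·t` through leaf-04's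
windowed inductive step.  This file is the junction: `u` is `(3|g|ρ² + |m|)`-Lipschitz on `|t| ≤ ρ` (§1: `u s − u t = (s − t)(g(s² + st +
t²) + m)`), the backgrounds take values in `[−r, r] ⊂ [−ρ, ρ]`, SISL's lift identity is the sitewise system, and the window readers apply.

WHAT IS PROVED ([folklore]; constants as in the region instance file, with `λ ≥ 3|g|ρ² + |m|`):
* §1 `abs_phiFour_sub_le` (`|u s − u t| ≤ (3|g|ρ² + |m|)·|s − t|` on the window), `sitewise_of_lift` (SISL's lift identity read as the
  sitewise background system).
* §2 **`exists_phiFour_region`** — `d ≥ 3`, `a > 0`, `g m : ℝ`, `0 ≤ r < ρ`, `3|g|ρ² + |m| ≤ λ`, `N ≥ N_∞`, `2λ ≤ c < N⁻¹`, an admissible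
  rate `μ` (`0 ≤ μ < δ_H ∧ δ_u∕4`, `2λC_Γ(μ) < 1`): ONE `A′ ≥ 0` and, for every side, the Nemytskii map, (60)'s operators and the `φ⁴`
  background `σ` with `σ 0 = 0`, the closed-ball letters (sitewise form), Lipschitz `(N⁻¹ − c)⁻¹`, AND the two REGION LETTERS of the
  region instance file for every pair `w, w′` in the chart ball.
* §3 toy.

HONEST (what this is NOT).  The small-field problem of the scalar caricature only; constants ∕ rates existential; no flow of `(g, m)`;
nothing of the covariant `H_k`, (A3) ∕ (A1c) (NC-NE7b-α UNRULED).  BY-NAME EFFECT ON THE WALL: NONE.  NE7b NOT PRINTED ∕ NOT PROVED;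
spine PROVED 0∕9; rung (B)+1 on a FINITE torus — NOT infinite volume, NOT the mass gap, NOT Clay.  HONEST DEPENDENCY: continuum YM on
T⁴ ⇐ BetaPertH ∧ nine spine estimates (0∕9 proved); BetaPertH ⇐ (D1) ∧ (D4) ∧ CAP+tail; G-an2-4 gates asym, D1 and NE2∕3∕4.
-/

set_option autoImplicit false

noncomputable section

namespace Summit.QuantumFields.BalabanUV.T4Continuum.NE7b.SupPhiFourRegion

open scoped ENNReal NNReal
open Metric Set
open Literature.MathematicalPhysics.QuantumFieldTheory.Balaban1983to89
open B4Sect5Proof (latticeConst latticeConst_nonneg)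
open B6QGQLower276 (X e blk B mem_B sum_B_const AX)
open B6QGQDecay237 (deltaU deltaU_pos)
open B5Hk103ScalarZd (nbhd deltaH deltaH_pos)
open Summit.QuantumFields.BalabanUV.Beta.D1BFx.BlockColumnSupNorm (cHs cHs_nonneg)
open Summit.QuantumFields.BalabanUV.Beta.D1BFx.PointColumnSplit (cKL cG0 cSplit)
open Summit.QuantumFields.BalabanUV.Beta.D1BFx.PointColumnDecay (cFar)
open BlockPropagatorSupNorm (supConstG_nonneg)
open LocalNemytskiiSup (abs_apply_le_norm)
open SupBackgroundGradientLocalised (exists_chart_gradient_weighted)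
open SupBackgroundRegionInstance (region_pair_value region_pair_gradient)
open SupPhiFourBackground (exists_phiFour_background)

variable {d : ℕ}

/-! ## §1. The window Lipschitz letter of `u`; the lift identity as the sitewise system -/

/-- On the window `|s|, |t| ≤ ρ`: `|u s − u t| ≤ (3|g|ρ² + |m|)·|s − t|` for `u(t) = g·t³ + m·t`. [folklore] -/
theorem abs_phiFour_sub_le (g m : ℝ) {ρ s t : ℝ} (hs : |s| ≤ ρ) (ht : |t| ≤ ρ) :
    |(g * s ^ 3 + m * s) - (g * t ^ 3 + m * t)| ≤ (3 * |g| * ρ ^ 2 + |m|) * |s - t| := by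
  have e : (g * s ^ 3 + m * s) - (g * t ^ 3 + m * t) = (g * (s ^ 2 + s * t + t ^ 2) + m) * (s - t) := by ring
  have hs2 : s ^ 2 ≤ ρ ^ 2 := by rw [← sq_abs s]; exact pow_le_pow_left₀ (abs_nonneg s) hs 2
  have ht2 : t ^ 2 ≤ ρ ^ 2 := by rw [← sq_abs t]; exact pow_le_pow_left₀ (abs_nonneg t) ht 2
  have hst : |s * t| ≤ ρ ^ 2 := by
    rw [abs_mul, sq]; exact mul_le_mul hs ht (abs_nonneg t) ((abs_nonneg s).trans hs)
  have hq : |s ^ 2 + s * t + t ^ 2| ≤ 3 * ρ ^ 2 := by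
    calc |s ^ 2 + s * t + t ^ 2| ≤ |s ^ 2 + s * t| + |t ^ 2| := abs_add_le _ _
      _ ≤ (|s ^ 2| + |s * t|) + |t ^ 2| := add_le_add (abs_add_le _ _) le_rfl
      _ ≤ (ρ ^ 2 + ρ ^ 2) + ρ ^ 2 := by rw [abs_of_nonneg (sq_nonneg s), abs_of_nonneg (sq_nonneg t)]; gcongr
      _ = 3 * ρ ^ 2 := by ring
  rw [e, abs_mul]
  refine mul_le_mul_of_nonneg_right ?_ (abs_nonneg _)
  calc |g * (s ^ 2 + s * t + t ^ 2) + m| ≤ |g * (s ^ 2 + s * t + t ^ 2)| + |m| := abs_add_le _ _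
    _ = |g| * |s ^ 2 + s * t + t ^ 2| + |m| := by rw [abs_mul]
    _ ≤ |g| * (3 * ρ ^ 2) + |m| := by gcongr
    _ = 3 * |g| * ρ ^ 2 + |m| := by ring

/-- **SISL's LIFT IDENTITY IS THE SITEWISE BACKGROUND SYSTEM**: if `Aφ + Nu φ = Lp(Q′(Aφ + Nu φ))` with the displayed actions of `Q′`,
`Lp` and `Nu φ i = u (φ i)`, then `Aφ + u∘φ` equals its own block mean at every site. [folklore] -/
theorem sitewise_of_lift {n : ℕ} {Dop Aop Lp : lp (fun _ : X d => ℝ) ∞ →L[ℝ] lp (fun _ : X d => ℝ) ∞}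
    {Nu : lp (fun _ : X d => ℝ) ∞ → lp (fun _ : X d => ℝ) ∞} {u : ℝ → ℝ}
    (hN : ∀ (φ : lp (fun _ : X d => ℝ) ∞) (i : X d), Nu φ i = u (φ i))
    (hD : ∀ (f : lp (fun _ : X d => ℝ) ∞) (y : X d), Dop f y = (((n : ℝ) + 1) ^ d)⁻¹ * ∑ p ∈ B n y, f p)
    (hLp : ∀ (f : lp (fun _ : X d => ℝ) ∞) (p : X d), Lp f p = f (blk n p))
    {φ : lp (fun _ : X d => ℝ) ∞} (hlift : Aop φ + Nu φ = Lp (Dop (Aop φ + Nu φ))) (p : X d) :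
    Aop φ p + u (φ p) = (((n : ℝ) + 1) ^ d)⁻¹ * ∑ p' ∈ B n (blk n p), (Aop φ p' + u (φ p')) := by
  have h := congrArg (fun f : lp (fun _ : X d => ℝ) ∞ => f p) hlift
  simp only [hLp, hD, lp.coeFn_add, Pi.add_apply, hN] at h
  exact h

/-! ## §2. The region letters of the `φ⁴` background -/

/-- **THE SMALL-FIELD REGION LETTERS OF LATTICE `φ⁴_d`** (`d ≥ 3`, `a > 0`; `u(t) = g·t³ + m·t`, `0 ≤ r < ρ`, `3|g|ρ² + |m| ≤ λ`,
`N ≥ N_∞`, `2λ ≤ c < N⁻¹`; an admissible rate `0 ≤ μ < δ_H`, `μ < δ_u∕4`, `2λC_Γ(μ) < 1`).  ONE `A′ ≥ 0` and, for every side, the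
Nemytskii map `Nu φ i = g(φ i)³ + m(φ i)`, the operators `Q′, A, P`, the background `σ` with `σ 0 = 0`, on `‖w‖ ≤ (N⁻¹ − c)r`: `‖σ w‖ ≤ r`,
`Q′(σ w) = w`, the sitewise system; `(N⁻¹ − c)⁻¹`-Lipschitz; AND for all `w, w′` in the chart ball, `p`, `D`, `ω ≥ 0` with
`|(w′ − w)(y)| ≤ ω` for `|y − blk p|_∞ < D`: `|(σw′ − σw)(p)| ≤ K₁(μ)(ω + ‖w′ − w‖e^{−μD})` and
`|(σw′ − σw)(p+e_ν) − (σw′ − σw)(p)| ≤ (n+1)⁻¹K₁′(μ)(ω + ‖w′ − w‖e^{−μD})`. [folklore] -/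
theorem exists_phiFour_region (hd : 3 ≤ d) {a : ℝ} (ha : 0 < a) (g m : ℝ) {ρ : ℝ} (hρ : 0 ≤ ρ)
    {lam c N : ℝ≥0} (hlam : 3 * |g| * ρ ^ 2 + |m| ≤ lam)
    (hN : cHs d a * latticeConst d (deltaH d a)
        + ((cG0 d * cKL d (d - 2) + cSplit d a) * Real.exp (2 * deltaU d a)
            + cFar d a * Real.exp (4 * deltaU d a) / deltaU d a ^ 2) * latticeConst d (deltaU d a / 4)
          * (1 + cHs d a * latticeConst d (deltaH d a)) ≤ (N : ℝ))
    (hc : 2 * lam ≤ c) (hcN : c < N⁻¹) {r : ℝ} (hr : 0 ≤ r) (hrρ : r < ρ)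
    {μ : ℝ} (hμ0 : 0 ≤ μ) (hμH : μ < deltaH d a) (hμU : μ < deltaU d a / 4)
    (hsmall : 2 * (lam : ℝ) * (((cG0 d * cKL d (d - 2) + cSplit d a) * Real.exp (2 * deltaU d a)
        + cFar d a * Real.exp (4 * deltaU d a) / deltaU d a ^ 2) * latticeConst d (deltaU d a / 4 - μ)
          * (1 + cHs d a * latticeConst d (deltaH d a - μ))) < 1) :
    ∃ A' : ℝ, 0 ≤ A' ∧ ∀ n : ℕ,
    ∃ (Nu : lp (fun _ : X d => ℝ) ∞ → lp (fun _ : X d => ℝ) ∞)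
      (Dop Aop Pop : lp (fun _ : X d => ℝ) ∞ →L[ℝ] lp (fun _ : X d => ℝ) ∞)
      (σ : lp (fun _ : X d => ℝ) ∞ → lp (fun _ : X d => ℝ) ∞),
      (∀ (φ : lp (fun _ : X d => ℝ) ∞) (i : X d), Nu φ i = g * (φ i) ^ 3 + m * (φ i)) ∧
      (∀ (f : lp (fun _ : X d => ℝ) ∞) (y : X d), Dop f y = (((n : ℝ) + 1) ^ d)⁻¹ * ∑ p ∈ B n y, f p) ∧
      (∀ (f : lp (fun _ : X d => ℝ) ∞) (p : X d), Aop f p = ∑ r ∈ nbhd n p, AX n a p r * f r) ∧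
      (∀ (f : lp (fun _ : X d => ℝ) ∞) (p : X d), Pop f p = f p - (((n : ℝ) + 1) ^ d)⁻¹ * ∑ p' ∈ B n (blk n p), f p') ∧
      σ 0 = 0 ∧
      (∀ w ∈ closedBall (0 : lp (fun _ : X d => ℝ) ∞) (((N : ℝ)⁻¹ - c) * r),
        σ w ∈ closedBall (0 : lp (fun _ : X d => ℝ) ∞) r ∧ Dop (σ w) = w ∧
          ∀ p : X d, Aop (σ w) p + (g * (σ w p) ^ 3 + m * (σ w p))
            = (((n : ℝ) + 1) ^ d)⁻¹ * ∑ p' ∈ B n (blk n p), (Aop (σ w) p' + (g * (σ w p') ^ 3 + m * (σ w p')))) ∧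
      LipschitzOnWith (N⁻¹ - c)⁻¹ σ (closedBall (0 : lp (fun _ : X d => ℝ) ∞) (((N : ℝ)⁻¹ - c) * r)) ∧
      (∀ w ∈ closedBall (0 : lp (fun _ : X d => ℝ) ∞) (((N : ℝ)⁻¹ - c) * r),
        ∀ w' ∈ closedBall (0 : lp (fun _ : X d => ℝ) ∞) (((N : ℝ)⁻¹ - c) * r),
        ∀ (p : X d) (D ω : ℝ), 0 ≤ ω → (∀ y, dist y (blk n p) < D → |(w' - w) y| ≤ ω) →
          |(σ w' - σ w) p|
            ≤ (1 - 2 * (lam : ℝ) * (((cG0 d * cKL d (d - 2) + cSplit d a) * Real.exp (2 * deltaU d a)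
                + cFar d a * Real.exp (4 * deltaU d a) / deltaU d a ^ 2) * latticeConst d (deltaU d a / 4 - μ)
                  * (1 + cHs d a * latticeConst d (deltaH d a - μ))))⁻¹
              * (cHs d a * latticeConst d (deltaH d a - μ)) * (ω + ‖w' - w‖ * Real.exp (-(μ * D))) ∧
          ∀ ν : Fin d, |(σ w' - σ w) (p + e ν) - (σ w' - σ w) p|
            ≤ ((n : ℝ) + 1)⁻¹ * (cHs d a * latticeConst d (deltaH d a - μ)
                + (A' * latticeConst d (deltaU d a / 4 - μ) + cHs d a * latticeConst d (deltaH d a - μ)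
                    * (((cG0 d * cKL d (d - 2) + cSplit d a) * Real.exp (2 * deltaU d a)
                        + cFar d a * Real.exp (4 * deltaU d a) / deltaU d a ^ 2) * latticeConst d (deltaU d a / 4 - μ)))
                  * (2 * lam * ((1 - 2 * (lam : ℝ) * (((cG0 d * cKL d (d - 2) + cSplit d a) * Real.exp (2 * deltaU d a)
                      + cFar d a * Real.exp (4 * deltaU d a) / deltaU d a ^ 2) * latticeConst d (deltaU d a / 4 - μ)
                        * (1 + cHs d a * latticeConst d (deltaH d a - μ))))⁻¹
                    * (cHs d a * latticeConst d (deltaH d a - μ)))))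
              * (ω + ‖w' - w‖ * Real.exp (-(μ * D)))) := by
  obtain ⟨A', hA0, hgradAll⟩ := exists_chart_gradient_weighted hd ha
  refine ⟨A', hA0, fun n => ?_⟩
  obtain ⟨Dop, Aop, Pop, hD, hA, hP, hgrad⟩ := hgradAll n
  obtain ⟨Nu, N', Dop', Aop', Pop', Lp, σ, hNapp, hD', hA', hP', hLp, hσ0, hσ, hlip, -, -, -, -⟩ :=
    exists_phiFour_background hd n ha g m hρ hlam hN hc hcN hr hrρ
  have eD : Dop' = Dop := ContinuousLinearMap.ext fun f => lp.ext (funext fun p => by rw [hD, hD'])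
  have eA : Aop' = Aop := ContinuousLinearMap.ext fun f => lp.ext (funext fun p => by rw [hA, hA'])
  have eP : Pop' = Pop := ContinuousLinearMap.ext fun f => lp.ext (funext fun p => by rw [hP, hP'])
  subst eD eA eP
  -- the sitewise system from the lift identity
  have hsys : ∀ w ∈ closedBall (0 : lp (fun _ : X d => ℝ) ∞) (((N : ℝ)⁻¹ - c) * r),
      σ w ∈ closedBall (0 : lp (fun _ : X d => ℝ) ∞) r ∧ Dop' (σ w) = w ∧
        ∀ p : X d, Aop' (σ w) p + (g * (σ w p) ^ 3 + m * (σ w p))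
          = (((n : ℝ) + 1) ^ d)⁻¹ * ∑ p' ∈ B n (blk n p), (Aop' (σ w) p' + (g * (σ w p') ^ 3 + m * (σ w p'))) := by
    intro w hw
    obtain ⟨hb, hDw, -, hlift⟩ := hσ w hw
    exact ⟨hb, hDw, fun p => sitewise_of_lift (u := fun t => g * t ^ 3 + m * t) hNapp hD' hLp hlift p⟩
  have hCH0 : 0 ≤ cHs d a * latticeConst d (deltaH d a - μ) :=
    mul_nonneg (cHs_nonneg d ha) (latticeConst_nonneg d (sub_pos.2 hμH).le)
  have hCΓ' : 0 ≤ A' * latticeConst d (deltaU d a / 4 - μ) + cHs d a * latticeConst d (deltaH d a - μ)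
      * (((cG0 d * cKL d (d - 2) + cSplit d a) * Real.exp (2 * deltaU d a)
          + cFar d a * Real.exp (4 * deltaU d a) / deltaU d a ^ 2) * latticeConst d (deltaU d a / 4 - μ)) :=
    add_nonneg (mul_nonneg hA0 (latticeConst_nonneg d (sub_pos.2 hμU).le))
      (mul_nonneg hCH0 (mul_nonneg (supConstG_nonneg d ha) (latticeConst_nonneg d (sub_pos.2 hμU).le)))
  -- `u` is `λ`-Lipschitz on the window `[−r, r]`
  have hr2 : r ^ 2 ≤ ρ ^ 2 := pow_le_pow_left₀ hr hrρ.le 2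
  have hulw : ∀ s t, |s| ≤ r → |t| ≤ r →
      |(fun t => g * t ^ 3 + m * t) s - (fun t => g * t ^ 3 + m * t) t| ≤ (lam : ℝ) * |s - t| := fun s t hs ht => by
    refine (abs_phiFour_sub_le g m hs ht).trans (mul_le_mul_of_nonneg_right ?_ (abs_nonneg _))
    refine le_trans ?_ hlam
    have : 3 * |g| * r ^ 2 ≤ 3 * |g| * ρ ^ 2 := mul_le_mul_of_nonneg_left hr2 (by positivity)
    linarith
  refine ⟨Nu, Dop', Aop', Pop', σ, hNapp, hD', hA', hP', hσ0, hsys, hlip, fun w hw w' hw' p D ω hω hnear => ?_⟩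
  obtain ⟨hb, hDw, hEw⟩ := hsys w hw
  obtain ⟨hb', hDw', hEw'⟩ := hsys w' hw'
  rw [mem_closedBall, dist_zero_right] at hb hb'
  have hbw : ∀ q, |σ w q| ≤ r := fun q => (abs_apply_le_norm (σ w) q).trans hb
  have hbw' : ∀ q, |σ w' q| ≤ r := fun q => (abs_apply_le_norm (σ w') q).trans hb'
  have hDd : Dop' (σ w' - σ w) = w' - w := by rw [map_sub, hDw, hDw']
  have hnear' : ∀ y, dist y (blk n p) < D → |Dop' (σ w' - σ w) y| ≤ ω := fun y hy => by rw [hDd]; exact hnear y hy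
  refine ⟨?_, fun ν => ?_⟩
  · have h := region_pair_value hd ha hD' hA' hP' (u := fun t => g * t ^ 3 + m * t) (NNReal.coe_nonneg lam) hr hulw hμ0 hμH hμU
      hsmall hbw' hbw hEw' hEw p hω hnear'
    rwa [hDd] at h
  · have h := region_pair_gradient hd ha hCΓ' hD' hA' hP' (fun hρ' φ' Rv Rκ hv' hκ' => hgrad hμ0 hμH hμU hρ' φ' hv' hκ')
      (u := fun t => g * t ^ 3 + m * t) (NNReal.coe_nonneg lam) hr hulw hμ0 hμH hμU hsmall hbw' hbw hEw' hEw p ν hω hnear'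
    rwa [hDd] at h

/-! ## §3. Toy -/

/-- Toy: the window Lipschitz constant by value — `g = 1∕10`, `m = 1∕100`, `ρ = 1`: `3|g|ρ² + |m| = 31∕100`. -/
example : 3 * |(1 / 10 : ℝ)| * 1 ^ 2 + |(1 / 100 : ℝ)| = 31 / 100 := by
  rw [abs_of_pos (by norm_num : (0:ℝ) < 1 / 10), abs_of_pos (by norm_num : (0:ℝ) < 1 / 100)]; norm_num

end Summit.QuantumFields.BalabanUV.T4Continuum.NE7b.SupPhiFourRegion

end
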